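import Mathlib
import Literature.MathematicalPhysics.QuantumFieldTheory.Balaban1983to89.B14
import Literature.MathematicalPhysics.QuantumFieldTheory.Balaban1983to89.Step

/-!
# `Balaban1983to89.B16Improved189` — the "improved bound (1.89)" of T. Bałaban, *Large field renormalization. II*,
Commun. Math. Phys. **122**, 355–392 (1989), doi:10.1007/bf01238433 [Balaban1989LargeFieldII], p. 387 [PDF 33].

CITATION HEADER (lean-in-tree rule 2026-08-18).  Reproduced: the arithmetic behind ONE sentence of a published paper
under adjudication by the audit cell `pub-balaban` (cell paper B16), p. 387 verbatim: *"Next, we have noticed already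
that the inequality (1.79) holds for the 𝐓-operation connected with an arbitrary large field region. The inequality
(1.80) holds quite generally for such regions, hence also an improved bound (1.89), with the additional term −κ₁d_k(X)
in the exponential. This implies the inequality (2.50) [III], hence Corollary 3."*  Nothing of the series is asserted.

WHAT IS CHECKED (cell GAPS row G-adv3-6, adversarial reader 3, gen 4).  For the domains `X` of (1.71) the inductive
statement (1.80) is EMPTY (p. 387: "satisfies the assumption of the statement with K = 0, therefore κ_k(X) ≥ 0";
`Step.Budget.controls_zero_iff`), so the "additional term −κ₁d_k(X)" cannot come from (1.80).  It IS available from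
the p₀-budget of (1.89) once HALF of that budget is spent on the linear size: condition (i) of B15 p. 177 (X inside a
cube of size 100MR_k) gives `d_k(X) ≤ (100R_k)^d` (`d_k` = shortest tree meeting all M-cubes of X, in M-units, B12
p. 257: a spanning tree of the ≤ (100R_k)^d face-connected M-cubes), and `κ₁(100R_k)^d ≤ (1+β₀)⁻¹p₀(g_k)` is a
g_k-smallness condition of exactly the kind Bałaban prints two pages later (p. 389: "1 + 2κ(100R_k)^d ≤ ¼p₀(g_k)",
`B16.budget_beta0_iff`), which holds under the exponent relation `p₀ ≥ d·r₀ + 1` (constants ledger G-B16-07 R9,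
`p₀ > (d+2)r₀`, is stronger).  Kernel-checked here:
* `improved189_of_halved_budget` — the pointwise trade `exp(−2ap) ≤ exp(−ap − κ₁ d)` when `κ₁ d ≤ a p`;
* `size_trade_of_exponents` — `κ₁ (100 R)^d ≤ (1+β₀)⁻¹ p₀(g)` for `R ≤ L x^{r₀}`, `x = log g⁻² ≥ x₀`, `p₀ ≥ d r₀ + 1`;
* `Rj_le_L_mul_pow` — `IsRj L r g R → 1 ≤ x^r → R ≤ L x^r` (minimality of the power of L in B14 (2.5));
* `improved189_of_budget_general` — the same with the (1.80)-term `n = k+1` for regions with `K ≥ 1`, GIVEN the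
  geometric comparison `d_k(X) ≤ c_geo (L R_{k+1})^d (d′_{k+1}(S(X)) + 1)` (a hypothesis: reader-level geometry).
The FULL-budget form printed on p. 387 (−2(1+β₀)⁻¹p₀(g_k) − κ₁d_k(X)) is NOT derived here: it needs (1.80) strengthened
by the term `κ₁ d_{j+K}(S^K(Z))` (sketch in GAPS G-adv3-6); what (2.50) [III] consumes is unprinted (GAPS G-adv3-2,
G-B16-08 (c)), so which budget suffices cannot be read off the text.
-/

namespace Literature.MathematicalPhysics.QuantumFieldTheory.Balaban1983to89.B16Improved189

open Literature.MathematicalPhysics.QuantumFieldTheory.Balaban1983to89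

/-- The pointwise trade: from the (1.89)-shape `T ≤ exp(−2ap)` (a = (1+β₀)⁻¹, p = p₀(g_k)) and `κ₁ d ≤ a p` follows the
"improved" shape with HALF the budget, `T ≤ exp(−ap − κ₁d)`. [cite: Balaban1989LargeFieldII, (1.89) p.387] -/
theorem improved189_of_halved_budget {V : Type*} (T1X : V → ℝ) (a p κ₁ dX : ℝ)
    (h189 : ∀ v, T1X v ≤ Real.exp (-(2 * a * p))) (htrade : κ₁ * dX ≤ a * p) :
    ∀ v, T1X v ≤ Real.exp (-(a * p) - κ₁ * dX) := by
  intro v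
  refine le_trans (h189 v) (Real.exp_le_exp.mpr ?_)
  linarith

/-- The same, stated with Setup's `p0Profile A₀ p₀ g` and the shape `Step.FundIneq189`. [cite: Balaban1989LargeFieldII, (1.89) p.387] -/
theorem improved189_of_fundIneq {V : Type*} (T1X : V → ℝ) (A₀ : ℝ) (p₀ : ℕ) (β₀ gk κ₁ dX : ℝ)
    (h189 : Step.FundIneq189 T1X A₀ p₀ β₀ gk)
    (htrade : κ₁ * dX ≤ (1 + β₀)⁻¹ * p0Profile A₀ p₀ gk) :
    ∀ v, T1X v ≤ Real.exp (-((1 + β₀)⁻¹ * p0Profile A₀ p₀ gk) - κ₁ * dX) :=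
  improved189_of_halved_budget T1X ((1 + β₀)⁻¹) (p0Profile A₀ p₀ gk) κ₁ dX
    (fun v => by simpa [mul_assoc, mul_left_comm, mul_comm] using h189 v) htrade

/-- B14 (2.5) p. 255 read as `B14.IsRj`: `R_j = L^s` for the LEAST `s` with `L^s ≥ x^r` (`x = log g_j⁻²`).  Minimality
gives `R_j ≤ L·x^r` as soon as `x^r ≥ 1`. [cite: Balaban1988Convergent, (2.5) p.255] -/
theorem Rj_le_L_mul_pow (L r : ℕ) (g : ℝ) (R : ℕ) (hL : 1 ≤ L)
    (hR : B14.IsRj L r g R) (hx : 1 ≤ (Real.log (g ^ 2)⁻¹) ^ r) :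
    (R : ℝ) ≤ (L : ℝ) * (Real.log (g ^ 2)⁻¹) ^ r := by
  obtain ⟨s, hs, hle, hmin⟩ := hR
  set x := (Real.log (g ^ 2)⁻¹) ^ r with hxdef
  have hL' : (1 : ℝ) ≤ (L : ℝ) := by exact_mod_cast hL
  rcases s with _ | s'
  · -- `s = 0`: `R = 1 ≤ x ≤ L x`
    have hR1 : (R : ℝ) = 1 := by rw [hs]; simp
    rw [hR1]
    calc (1 : ℝ) ≤ x := hx
      _ = 1 * x := (one_mul x).symm
      _ ≤ (L : ℝ) * x := mul_le_mul_of_nonneg_right hL' (le_trans zero_le_one hx)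
  · -- `s = s'+1`: minimality forbids `x ≤ L^{s'}`, so `L^{s'} < x` and `R = L·L^{s'} < L x`
    have hlt : ((L ^ s' : ℕ) : ℝ) < x := by
      by_contra hcon
      push Not at hcon
      have := hmin s' hcon
      omega
    have hRcast : (R : ℝ) = (L : ℝ) * ((L ^ s' : ℕ) : ℝ) := by
      rw [hs]; push_cast; ring
    rw [hRcast]
    have hL0 : (0 : ℝ) ≤ (L : ℝ) := by linarith
    exact mul_le_mul_of_nonneg_left hlt.le hL0

/-- The size trade as an exponent relation.  With `x = log g⁻²`, `p₀(g) = A₀ x^{p₀}` (`Setup.p0Profile`) and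
`R ≤ L x^{r₀}`: if `p₀ ≥ d·r₀ + 1` and `x ≥ max 1 ((1+β₀) κ₁ (100 L)^d / A₀)` then `κ₁ (100 R)^d ≤ (1+β₀)⁻¹ p₀(g)`.
This is the "g_k sufficiently small" of p. 389 made explicit; the ledger relation R9 `p₀ > (d+2) r₀` (GAPS G-B16-07)
implies `p₀ ≥ d r₀ + 1`. [cite: Balaban1989LargeFieldII, p.387, p.389] -/
theorem size_trade_of_exponents (A₀ β₀ κ₁ L x R : ℝ) (d r₀ p₀ : ℕ)
    (hA : 0 < A₀) (hβ : 0 ≤ β₀) (hκ : 0 ≤ κ₁) (hR0 : 0 ≤ R)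
    (hx1 : 1 ≤ x) (hR : R ≤ L * x ^ r₀) (hp : d * r₀ + 1 ≤ p₀)
    (hx : (1 + β₀) * κ₁ * (100 * L) ^ d / A₀ ≤ x) :
    κ₁ * (100 * R) ^ d ≤ (1 + β₀)⁻¹ * (A₀ * x ^ p₀) := by
  have hβpos : 0 < 1 + β₀ := by linarith
  have hx0 : 0 ≤ x := by linarith
  -- (100 R)^d ≤ (100 L)^d x^{d r₀}
  have h1 : (100 * R) ^ d ≤ (100 * L) ^ d * x ^ (d * r₀) := by
    have : 100 * R ≤ 100 * L * x ^ r₀ := by nlinarith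
    calc (100 * R) ^ d ≤ (100 * L * x ^ r₀) ^ d :=
          pow_le_pow_left₀ (by positivity) this d
      _ = (100 * L) ^ d * x ^ (d * r₀) := by rw [mul_pow, ← pow_mul, mul_comm r₀ d]
  -- x^{p₀} ≥ x · x^{d r₀}
  have h2 : x * x ^ (d * r₀) ≤ x ^ p₀ := by
    calc x * x ^ (d * r₀) = x ^ (d * r₀ + 1) := by ring
      _ ≤ x ^ p₀ := pow_le_pow_right₀ hx1 hp
  -- A₀ x ≥ (1+β₀) κ₁ (100 L)^d
  have h3 : (1 + β₀) * κ₁ * (100 * L) ^ d ≤ A₀ * x := by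
    rwa [div_le_iff₀ hA, mul_comm x A₀] at hx
  have hxd : 0 ≤ x ^ (d * r₀) := by positivity
  -- assemble: (1+β₀) κ₁ (100R)^d ≤ (1+β₀) κ₁ (100L)^d x^{dr₀} ≤ A₀ x x^{dr₀} ≤ A₀ x^{p₀}
  have key : (1 + β₀) * (κ₁ * (100 * R) ^ d) ≤ A₀ * x ^ p₀ := by
    calc (1 + β₀) * (κ₁ * (100 * R) ^ d)
        ≤ (1 + β₀) * (κ₁ * ((100 * L) ^ d * x ^ (d * r₀))) := by
          apply mul_le_mul_of_nonneg_left _ hβpos.le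
          exact mul_le_mul_of_nonneg_left h1 hκ
      _ = ((1 + β₀) * κ₁ * (100 * L) ^ d) * x ^ (d * r₀) := by ring
      _ ≤ (A₀ * x) * x ^ (d * r₀) := mul_le_mul_of_nonneg_right h3 hxd
      _ = A₀ * (x * x ^ (d * r₀)) := by ring
      _ ≤ A₀ * x ^ p₀ := mul_le_mul_of_nonneg_left h2 hA.le
  rw [← div_eq_inv_mul, le_div_iff₀ hβpos]
  linarith

/-- The (1.71)-domain case assembled: (i) of B15 p. 177 as `d_k(X) ≤ (100 R_k)^d`, the exponent relation, and (1.89)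
give the improved bound with the halved budget. [cite: Balaban1989LargeFieldII, (1.89) p.387; Balaban1989LargeFieldI, p.177 (i)] -/
theorem improved189_of_condition_i {V : Type*} (T1X : V → ℝ) (A₀ β₀ κ₁ L x dX : ℝ) (R : ℝ) (d r₀ p₀ : ℕ)
    (hA : 0 < A₀) (hβ : 0 ≤ β₀) (hκ : 0 ≤ κ₁) (hR0 : 0 ≤ R)
    (hx1 : 1 ≤ x) (hR : R ≤ L * x ^ r₀) (hp : d * r₀ + 1 ≤ p₀)
    (hx : (1 + β₀) * κ₁ * (100 * L) ^ d / A₀ ≤ x)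
    (hgeo : dX ≤ (100 * R) ^ d)
    (h189 : ∀ v, T1X v ≤ Real.exp (-(2 * (1 + β₀)⁻¹ * (A₀ * x ^ p₀)))) :
    ∀ v, T1X v ≤ Real.exp (-((1 + β₀)⁻¹ * (A₀ * x ^ p₀)) - κ₁ * dX) := by
  apply improved189_of_halved_budget T1X ((1 + β₀)⁻¹) (A₀ * x ^ p₀) κ₁ dX h189
  calc κ₁ * dX ≤ κ₁ * (100 * R) ^ d := mul_le_mul_of_nonneg_left hgeo hκ
    _ ≤ (1 + β₀)⁻¹ * (A₀ * x ^ p₀) :=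
        size_trade_of_exponents A₀ β₀ κ₁ L x R d r₀ p₀ hA hβ hκ hR0 hx1 hR hp hx

/-- Regions with `K ≥ 1` (the "arbitrary large field region" of p. 387): the `n = k+1` term of (1.80) is
`C M^d R_{k+1}^{d+1} d′_{k+1}(S(X))` (`Step.Budget.Consts.cost`), and GIVEN the geometric comparison
`d_k(X) ≤ c (L R_{k+1})^d (d′ + 1)` (X ⊂ S(X), a union of ≤ 3^d(2d′+1) `MR_{k+1}`-cubes each holding `(L R_{k+1})^d`
M-cubes of scale k — reader-level geometry, a HYPOTHESIS here) one gets `κ_k(X) ≥ κ₁ d_k(X) − κ₁ c (L R_{k+1})^d`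
whenever `κ₁ c L^d ≤ C M^d R_{k+1}`; the deficit is again a `(const·R)^d`-term paid by half the p₀-budget.
[cite: Balaban1989LargeFieldII, (1.80) p.384, p.387] -/
theorem improved189_of_budget_general {V : Type*} (T1X : V → ℝ) (b : Step.Budget.Consts) (k : ℕ)
    (κ P a p κ₁ dX d' c L : ℝ)
    (hT : ∀ v, T1X v ≤ Real.exp (-κ - P))
    (hcost : b.cost (k + 1) d' ≤ κ)
    (hgeo : dX ≤ c * (L * b.R (k + 1)) ^ b.d * (d' + 1))
    (hκ : 0 ≤ κ₁) (hL : 0 ≤ L) (hR : 0 ≤ b.R (k + 1)) (hd' : 0 ≤ d')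
    (hslope : κ₁ * c * L ^ b.d ≤ b.C * b.M ^ b.d * b.R (k + 1))
    (hP : 2 * a * p ≤ P)
    (hdef : κ₁ * (c * (L * b.R (k + 1)) ^ b.d) ≤ a * p) :
    ∀ v, T1X v ≤ Real.exp (-(a * p) - κ₁ * dX) := by
  intro v
  refine le_trans (hT v) (Real.exp_le_exp.mpr ?_)
  -- κ ≥ κ₁ c (L R)^d d'  from the cost term and the slope condition
  have hRd : 0 ≤ (L * b.R (k + 1)) ^ b.d := by positivity
  have hκd : κ₁ * (c * (L * b.R (k + 1)) ^ b.d) * d' ≤ κ := by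
    have : κ₁ * (c * (L * b.R (k + 1)) ^ b.d) * d'
        = (κ₁ * c * L ^ b.d) * (b.R (k + 1)) ^ b.d * d' := by rw [mul_pow]; ring
    rw [this]
    have hRpow : 0 ≤ (b.R (k + 1)) ^ b.d := by positivity
    calc (κ₁ * c * L ^ b.d) * (b.R (k + 1)) ^ b.d * d'
        ≤ (b.C * b.M ^ b.d * b.R (k + 1)) * (b.R (k + 1)) ^ b.d * d' := by
          apply mul_le_mul_of_nonneg_right _ hd'
          exact mul_le_mul_of_nonneg_right hslope hRpow
      _ = b.cost (k + 1) d' := by unfold Step.Budget.Consts.cost; ring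
      _ ≤ κ := hcost
  have hκdX : κ₁ * dX ≤ κ₁ * (c * (L * b.R (k + 1)) ^ b.d) * d' + κ₁ * (c * (L * b.R (k + 1)) ^ b.d) := by
    have := mul_le_mul_of_nonneg_left hgeo hκ
    nlinarith
  linarith

end Literature.MathematicalPhysics.QuantumFieldTheory.Balaban1983to89.B16Improved189
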